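import Summits.ResolutionOfSingularities.ResolutionOfSingularities.Theorems.FrobeniusClosingSteerLowTamingGerms
import Summits.ResolutionOfSingularities.ResolutionOfSingularities.Theorems.FrobeniusClosingSteerSwitchPlaneChart
import Summits.ResolutionOfSingularities.ResolutionOfSingularities.Theorems.FrobeniusClosingSteerRadicandNormalNoSingularCurve
import Summits.ResolutionOfSingularities.ResolutionOfSingularities.Theorems.FrobeniusClosingSteerRadicandSingularCriterion
import Literature.AlgebraicGeometry.Resolution.RegularLocalRingsQuotient
import Literature.AlgebraicGeometry.Resolution.QuadraticTransformDelta
import HarnessLib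

/-!
# Bad curves across one point stage of the LOW tower (D3c, W4.1 — F5 (ii) per step)

W4.1, crux `Steer` (stmt-ResolutionOfSingularities-16345), σ-line at `p = 2`, LOW half, piece **D3c = F5 TAMING**
(res-L0-w41-plan-1 RULINGS 18d/41; §σ2.24 `LowTowerTamingTwo`). Theses-free, def-free. For ONE point stage `S ⊂ S'`
(quadratic transform of regular local subrings of the field `L`, chart `x`, radicand law `f' x² = f − g²`, characteristic `2`)
and a prime `𝔮'` of `S'` which is neither `⊥` nor `𝔪`:

* `exceptional_quotient_isRegularLocalRing` — if `x ∈ 𝔮'` (the EXCEPTIONAL curve) then `S' ⧸ 𝔮'` is regular: the exceptional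
  parameter is a regular parameter of the transform (`SwitchPlane.excParam_not_mem_sq_transform`, HLOST 2.7), so `(x)` is a height-one
  prime with regular quotient and `𝔮' = (x)`; hence a BAD curve is never exceptional;
* `singular_comap_of_singular` — off the exceptional curve, if the torsor `T² = f'` is singular at `𝔮'` then `T² = f` is singular at
  `𝔮' ∩ S` (res-type-082's criterion both ways, the radicand law with `x` a unit, and `(S')_{𝔮'} ≅ S_{𝔮' ∩ S}` —
  `BadCurveStep.isLocalization_atPrime_of_quadraticTransform`);
* `isRegularLocalRing_quotient_of_comap` — off the exceptional curve, if `S ⧸ (𝔮' ∩ S)` is regular then so is `S' ⧸ 𝔮'`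
  (a two-stage instance of the lineage machinery: the germ of `𝔮'` is a quadratic transform of the germ of `𝔮' ∩ S`, a discrete
  valuation ring, hence equal to it — res-D-pv-012's (M1) + `IsQuadraticTransform.eq_self_of_isDiscreteValuationRing`).
Together: the BAD curves of `S'` (singular, non-regular quotient) contract injectively to bad curves of `S`.

No Theses file of W4.1 is imported; nothing here is a route item. OURS (the W4.1 engine), standard commutative algebra;
NOT a statement of the manuscript under review [claim: Hironaka2017, status: under-review]. [cite: Cutkosky2014, §2.1]
[cite: Matsumura1987, Thm. 14.2] [cite: Kollar2007, §1.4] [folklore]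
-/

noncomputable section

-- `Summit.<S>.<S>.…` duplicates the summit name by design (single-problem summit).
set_option linter.dupNamespace false

open Polynomial IsLocalRing Literature.AlgebraicGeometry.Resolution

namespace Summit.ResolutionOfSingularities.ResolutionOfSingularities.Theorems.SwitchingDichotomy.LowTamingStep

variable {L : Type} [Field L]

/-! ## §1 The exceptional curve has a regular quotient -/

/-- In a local domain of Krull dimension two, a prime neither `⊥` nor `𝔪` containing a PRIME element `x` is `(x)`. [folklore] -/
theorem eq_span_singleton_of_mem {S : Type*} [CommRing S] [IsDomain S] [IsLocalRing S] [IsNoetherianRing S]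
    (hdim : ringKrullDim S = (2 : ℕ)) {x : S} (hx : Prime x) (𝔮 : Ideal S) [𝔮.IsPrime] (h0 : 𝔮 ≠ ⊥)
    (hm : 𝔮 ≠ maximalIdeal S) (hx𝔮 : x ∈ 𝔮) : 𝔮 = Ideal.span {x} := by
  have h1 : 𝔮.height = 1 := RadicandNormal.height_eq_one_of_ne_bot_of_ne_maximalIdeal hdim 𝔮 h0 hm
  haveI hp : (Ideal.span {x}).IsPrime := (Ideal.span_singleton_prime hx.ne_zero).mpr hx
  have hle : Ideal.span {x} ≤ 𝔮 := (Ideal.span_singleton_le_iff_mem _).mpr hx𝔮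
  have hx0 : Ideal.span {x} ≠ ⊥ := by
    rw [Ne, Ideal.span_singleton_eq_bot]; exact hx.ne_zero
  haveI : (Ideal.span {x}).FiniteHeight := Ideal.finiteHeight_of_le hle (Ideal.IsPrime.ne_top ‹_›)
  -- `1 ≤ height (x) ≤ height 𝔮 = 1`
  have hxh : (Ideal.span {x}).height = 1 := by
    apply le_antisymm
    · rw [← h1]; exact Ideal.height_mono hle
    · have : (Ideal.span {x}).height ≠ 0 := fun h => hx0 (Ideal.height_eq_zero_iff_eq_bot.mp h)
      exact Order.one_le_iff_ne_zero.mpr this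
  exact (Ideal.eq_of_le_of_height_le (Ideal.span {x}) hle (by rw [h1, hxh])).symm

/-- **The exceptional curve has a regular quotient.** Point stage `S ⊂ S'` in the chart of `x` (`S` regular local and
Noetherian, `S'` regular local of dimension two, all inside the field `L`); a prime `𝔮'` of `S'`, neither `⊥` nor `𝔪`, containing
`x`: then `S' ⧸ 𝔮'` is a regular local ring (`x` is a regular parameter of `S'`, HLOST 2.7, so `𝔮' = (x)`). Hence a bad curve is
never the exceptional one. [cite: HeinzerEtAl2015, Lemma 2.7] [cite: Matsumura1987, Thm. 14.2] -/
theorem exceptional_quotient_isRegularLocalRing {S S' : Subring L} [IsRegularLocalRing S] [IsRegularLocalRing S']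
    (hdim' : ringKrullDim S' = (2 : ℕ)) {x : L} (hxS : x ∈ S) (hxm : (⟨x, hxS⟩ : S) ∈ maximalIdeal S) (hx0 : x ≠ 0)
    (hB : blowupRing S x ≤ S')
    (hfrac : ∀ z ∈ S', ∃ a ∈ blowupRing S x, ∃ b ∈ blowupRing S x, b⁻¹ ∈ S' ∧ z = a / b)
    (hdom : SubringDominates S S')
    (𝔮' : Ideal S') [𝔮'.IsPrime] (h0 : 𝔮' ≠ ⊥) (hm : 𝔮' ≠ maximalIdeal S')
    (hx𝔮 : (⟨x, hdom.1 hxS⟩ : S') ∈ 𝔮') : IsRegularLocalRing (S' ⧸ 𝔮') := by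
  haveI := isDomain_of_isRegularLocalRing S'
  obtain ⟨O, hO⟩ := LowTamingGerms.exists_valuationSubring_dominates S'
  obtain ⟨-, hSO, hdiv, hbl⟩ := LowTamingGerms.eq_locAtCentre_of_chart hxS hxm hx0 hB hfrac hdom hO
  have hdomO : SubringDominates S O.toSubring := hdom.trans hO
  have hmax : ∀ y : S, y ∈ maximalIdeal S → O.valuation (y : L) ≤ O.valuation x := by
    intro y hy
    have h1 : O.valuation ((y : L) / x) ≤ 1 := (O.valuation_le_one_iff _).mpr (hdiv y hy)
    rwa [map_div₀, div_le_one₀ (zero_lt_iff.mpr ((_root_.map_ne_zero _).mpr hx0))] at h1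
  obtain ⟨_, hx', -, hxm', hx2'⟩ := SwitchPlane.excParam_not_mem_sq_transform hbl hdomO hxS hxm hx0 hmax
  have hprime : Prime (⟨x, hx'⟩ : S') := IsRegularLocalRing.prime_of_not_mem_sq hxm' hx2'
  have heq : 𝔮' = Ideal.span {(⟨x, hx'⟩ : S')} :=
    eq_span_singleton_of_mem hdim' hprime 𝔮' h0 hm hx𝔮
  rw [heq]
  exact (IsRegularLocalRing.quotient_span_singleton hxm' hx2').1

/-! ## §2 Singularity contracts -/

/-- Transport of the criterion datum `f − γ² ∈ 𝔪²` along an `S`-algebra isomorphism of local `S`-algebras. [folklore] -/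
theorem exists_sub_sq_mem_sq_of_algEquiv {S : Type*} [CommRing S] {B C : Type*} [CommRing B] [CommRing C]
    [IsLocalRing B] [IsLocalRing C] [Algebra S B] [Algebra S C] (e : B ≃ₐ[S] C) (f : S)
    (h : ∃ γ : C, algebraMap S C f - γ ^ 2 ∈ maximalIdeal C ^ 2) :
    ∃ γ : B, algebraMap S B f - γ ^ 2 ∈ maximalIdeal B ^ 2 := by
  obtain ⟨γ, hγ⟩ := h
  refine ⟨e.symm γ, ?_⟩
  have hmap : Ideal.map (e.symm : C →+* B) (maximalIdeal C) ≤ maximalIdeal B := by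
    rw [Ideal.map_le_iff_le_comap]
    intro c hc
    rw [Ideal.mem_comap]
    exact map_nonunit (e.symm : C →+* B) c hc
  have h1 : (e.symm : C →+* B) (algebraMap S C f - γ ^ 2) ∈ maximalIdeal B ^ 2 := by
    have := Ideal.mem_map_of_mem (e.symm : C →+* B) hγ
    rw [Ideal.map_pow] at this
    exact Ideal.pow_right_mono hmap 2 this
  have h2 : (e.symm : C →+* B) (algebraMap S C f - γ ^ 2) = algebraMap S B f - e.symm γ ^ 2 := by
    rw [map_sub, map_pow]
    congr 1
    exact e.symm.commutes f
  rwa [h2] at h1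

/-- **Singularity contracts across a point stage.** Point stage `S ⊂ S'` (regular local subrings of `L`, characteristic `2`), chart
`x`, radicand law `f' · x² = f − g²` (`f, g ∈ S`, `f' ∈ S'`); a prime `𝔮'` of `S'` off the exceptional curve (`𝔮' ∩ S ≠ 𝔪_S`). If the
torsor `T² = f'` is singular at `𝔮'`, then `T² = f` is singular at `𝔮' ∩ S`. [cite: Matsumura1987, Thm. 14.2] [cite: Cutkosky2014, §2.1] -/
theorem singular_comap_of_singular [CharP L 2] {S S' : Subring L} [IsRegularLocalRing S] [IsRegularLocalRing S']
    (hqt : IsQuadraticTransform S S') {x : L} (hxS : x ∈ S) (hx0 : x ≠ 0) (hB : blowupRing S x ≤ S')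
    {f g : S} {f' : S'} (hlaw : (f' : L) * x ^ 2 = (f : L) - (g : L) ^ 2)
    (𝔮' : Ideal S') [𝔮'.IsPrime] (hne : 𝔮'.comap (Subring.inclusion hqt.dominates.1) ≠ maximalIdeal S)
    (hsing' : ¬ IsRegularLocalRing (AdjoinRoot ((X : (Localization.AtPrime 𝔮')[X]) ^ 2 -
      C (algebraMap S' (Localization.AtPrime 𝔮') f')))) :
    haveI := Ideal.comap_isPrime (Subring.inclusion hqt.dominates.1) 𝔮'
    ¬ IsRegularLocalRing (AdjoinRoot ((X : (Localization.AtPrime (𝔮'.comap (Subring.inclusion hqt.dominates.1)))[X]) ^ 2 -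
      C (algebraMap S (Localization.AtPrime (𝔮'.comap (Subring.inclusion hqt.dominates.1))) f))) := by
  haveI : Fact (Nat.Prime 2) := ⟨Nat.prime_two⟩
  haveI := Ideal.comap_isPrime (Subring.inclusion hqt.dominates.1) 𝔮'
  set 𝔮 : Ideal S := 𝔮'.comap (Subring.inclusion hqt.dominates.1) with h𝔮
  set L' := Localization.AtPrime 𝔮' with hL'
  haveI : IsRegularLocalRing L' := isRegularLocalRing_localization_atPrime S' 𝔮'
  haveI : CharP L' 2 := RadicandLocalization.charP_localization_atPrime 2 𝔮'
  haveI : IsRegularLocalRing (Localization.AtPrime 𝔮) := isRegularLocalRing_localization_atPrime S 𝔮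
  haveI : CharP (Localization.AtPrime 𝔮) 2 := RadicandLocalization.charP_localization_atPrime 2 𝔮
  -- the criterion at `𝔮'`
  obtain ⟨γ', hγ'⟩ := (RadicandSingular.not_isRegularLocalRing_adjoinRoot_atPrime_iff 2 𝔮' f').mp hsing'
  -- the radicand law in `L'`, with `x` a unit
  have hle := hqt.dominates.1
  have hxq' : Subring.inclusion hle ⟨x, hxS⟩ ∉ 𝔮' :=
    BadCurveStep.not_mem_of_comap_ne_maximalIdeal hle (x := ⟨x, hxS⟩) hx0 hB 𝔮' hne
  have hxu : IsUnit (algebraMap S' L' (Subring.inclusion hle ⟨x, hxS⟩)) :=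
    IsLocalization.map_units L' (⟨_, hxq'⟩ : 𝔮'.primeCompl)
  have hlawS' : f' * (Subring.inclusion hle ⟨x, hxS⟩) ^ 2 =
      Subring.inclusion hle f - (Subring.inclusion hle g) ^ 2 := Subtype.ext hlaw
  have hlaw' : algebraMap S' L' f' * (algebraMap S' L' (Subring.inclusion hle ⟨x, hxS⟩)) ^ 2 =
      algebraMap S' L' (Subring.inclusion hle f) - (algebraMap S' L' (Subring.inclusion hle g)) ^ 2 := by
    have h := congrArg (algebraMap S' L') hlawS'
    simpa only [map_mul, map_pow, map_sub] using h
  obtain ⟨γ, hγ⟩ := (BadCurveStep.exists_sub_sq_mem_iff_of_pointStep (maximalIdeal L' ^ 2) hxu hlaw').mp ⟨γ', hγ'⟩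
  -- transport to `S_𝔮` along `(S')_{𝔮'} ≅ S_𝔮`
  letI : Algebra S L' := ((algebraMap S' L').comp (Subring.inclusion hle)).toAlgebra
  haveI : IsLocalization.AtPrime L' 𝔮 := BadCurveStep.isLocalization_atPrime_of_quadraticTransform hqt 𝔮' hne
  let e : Localization.AtPrime 𝔮 ≃ₐ[S] L' := IsLocalization.algEquiv 𝔮.primeCompl (Localization.AtPrime 𝔮) L'
  have hγS : algebraMap S L' f - γ ^ 2 ∈ maximalIdeal L' ^ 2 := hγ
  obtain ⟨γ₀, hγ₀⟩ := exists_sub_sq_mem_sq_of_algEquiv e f ⟨γ, hγS⟩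
  exact (RadicandSingular.not_isRegularLocalRing_adjoinRoot_atPrime_iff 2 𝔮 f).mpr ⟨γ₀, hγ₀⟩

/-! ## §3 Regular quotients persist -/

/-- **A regular curve stays regular across a point stage.** Point stage `S ⊂ S'` in the chart of `x` (local Noetherian subrings
of `L`), `𝔮'` a prime of `S'` off the exceptional curve with `𝔮' ∩ S` not maximal; if `S ⧸ (𝔮' ∩ S)` is a discrete valuation ring
(a regular curve germ) then `S' ⧸ 𝔮'` is a regular local ring: in the residue frame of `S_{𝔮' ∩ S}` the germ of `𝔮'` is a quadratic
transform (res-D-pv-012's (M1)) of the germ of `𝔮' ∩ S`, a DVR, hence equal to it. [cite: Kollar2007, Lemma 1.99] [cite: Cutkosky2014, §2.1] -/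
theorem isRegularLocalRing_quotient_of_comap {S S' : Subring L} [IsLocalRing S] [IsLocalRing S'] [IsNoetherianRing S]
    {x : L} (hxS : x ∈ S) (hxm : (⟨x, hxS⟩ : S) ∈ maximalIdeal S) (hx0 : x ≠ 0)
    (hB : blowupRing S x ≤ S')
    (hfrac : ∀ z ∈ S', ∃ a ∈ blowupRing S x, ∃ b ∈ blowupRing S x, b⁻¹ ∈ S' ∧ z = a / b)
    (hdom : SubringDominates S S')
    (𝔮' : Ideal S') [𝔮'.IsPrime] (hne : 𝔮'.comap (Subring.inclusion hdom.1) ≠ maximalIdeal S)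
    (hreg : haveI := Ideal.comap_isPrime (Subring.inclusion hdom.1) 𝔮';
      IsDiscreteValuationRing (S ⧸ 𝔮'.comap (Subring.inclusion hdom.1))) :
    IsRegularLocalRing (S' ⧸ 𝔮') := by
  classical
  haveI h𝔮 := Ideal.comap_isPrime (Subring.inclusion hdom.1) 𝔮'
  set 𝔮 : Ideal S := 𝔮'.comap (Subring.inclusion hdom.1) with h𝔮def
  have hle : S ≤ S' := hdom.1
  have hqt : IsQuadraticTransform S S' :=
    ⟨inferInstance, ⟨x, hxS⟩, hxm, fun h => hx0 (congrArg Subtype.val h), inferInstance, hB, hfrac, hdom⟩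
  have hneq : (𝔮').comap (Subring.inclusion hqt.dominates.1) ≠ maximalIdeal S := hne
  /- the frame `V = S_𝔮`, `j : V → L`, `Λ = j(V)`, `φ = residue ∘ j⁻¹` -/
  set V := Localization.AtPrime 𝔮 with hV
  have hunit : ∀ s : 𝔮.primeCompl, IsUnit (S.subtype s) := by
    intro s
    refine isUnit_iff_ne_zero.mpr fun h0 => s.2 ?_
    have : (s : S) = 0 := Subtype.ext h0
    rw [this]; exact Ideal.zero_mem _
  set j : V →+* L := IsLocalization.lift (M := 𝔮.primeCompl) (S := V) hunit with hj
  have hjalg : ∀ a : S, j (algebraMap S V a) = (a : L) := fun a => IsLocalization.lift_eq hunit a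
  have hjinj : Function.Injective j := by
    rw [hj, IsLocalization.lift_injective_iff]
    intro a b
    constructor
    · intro h
      rw [(IsLocalization.injective V 𝔮.primeCompl_le_nonZeroDivisors) h]
    · intro h
      rw [show a = b from Subtype.ext h]
  set Λ : Subring L := j.range with hΛ
  have hjmem : ∀ v : V, j v ∈ Λ := fun v => ⟨v, rfl⟩
  set e : V ≃+* Λ := RingEquiv.ofBijective j.rangeRestrict
    ⟨fun a b h => hjinj (congrArg Subtype.val h), RingHom.rangeRestrict_surjective j⟩ with he
  have he_symm : ∀ (v : V), e.symm ⟨j v, hjmem v⟩ = v := fun v => by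
    apply e.injective; rw [RingEquiv.apply_symm_apply]; exact Subtype.ext rfl
  set φ : Λ →+* ResidueField V := (IsLocalRing.residue V).comp e.symm.toRingHom with hφ
  have hφj : ∀ v : V, φ ⟨j v, hjmem v⟩ = IsLocalRing.residue V v := fun v => by
    change IsLocalRing.residue V (e.symm ⟨j v, hjmem v⟩) = _
    rw [he_symm]
  have hker : ∀ r : Λ, φ r = 0 → ¬ IsUnit r := by
    intro r hr hu
    obtain ⟨v, hv⟩ : ∃ v : V, (⟨j v, hjmem v⟩ : Λ) = r := by
      obtain ⟨v, hv⟩ := RingHom.rangeRestrict_surjective j r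
      exact ⟨v, by rw [← hv]; rfl⟩
    subst hv
    rw [hφj, IsLocalRing.residue_eq_zero_iff] at hr
    apply hr
    have : IsUnit (e.symm ⟨j v, hjmem v⟩) := hu.map e.symm
    rwa [he_symm] at this
  have hΛmem : ∀ {z : L} (a b : S), b ∉ 𝔮 → z * (b : L) = a →
      ∃ hz : z ∈ Λ, (φ ⟨z, hz⟩ = 0 ↔ a ∈ 𝔮) := by
    intro z a b hb hzb
    set v : V := IsLocalization.mk' V a (⟨b, hb⟩ : 𝔮.primeCompl) with hv
    have hjv : j v = z := by
      rw [hv, hj, IsLocalization.lift_mk'_spec]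
      change (a : L) = (b : L) * z
      rw [← hzb, mul_comm]
    refine ⟨hjv ▸ hjmem v, ?_⟩
    have : (⟨z, hjv ▸ hjmem v⟩ : Λ) = ⟨j v, hjmem v⟩ := Subtype.ext hjv.symm
    rw [this, hφj, IsLocalRing.residue_eq_zero_iff, hv,
      IsLocalization.AtPrime.mk'_mem_maximal_iff V 𝔮 a (⟨b, hb⟩ : 𝔮.primeCompl)]
  have hΛunit : ∀ r : Λ, φ r ≠ 0 → IsUnit r := by
    intro r hr
    have h1 : IsUnit (e.symm r) := (IsLocalRing.residue_ne_zero_iff_isUnit _).mp hr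
    have h2 := h1.map e
    rwa [RingEquiv.apply_symm_apply] at h2
  -- base: `S ≤ Λ`, kernel `𝔮`
  have hSΛ : S ≤ Λ := fun z hz =>
    (hΛmem ⟨z, hz⟩ 1 (fun h1 => (Ideal.ne_top_iff_one _).mp (Ideal.IsPrime.ne_top inferInstance) h1)
      (by rw [OneMemClass.coe_one, mul_one])).1
  have hkS : ∀ z : S, z ∈ 𝔮 ↔ φ (Subring.inclusion hSΛ z) = 0 := by
    intro z
    obtain ⟨hz, hiff⟩ := hΛmem z 1 (fun h1 => (Ideal.ne_top_iff_one _).mp (Ideal.IsPrime.ne_top inferInstance) h1)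
      (by rw [OneMemClass.coe_one, mul_one])
    exact hiff.symm
  -- step: `S' ≤ Λ`, kernel `𝔮'`
  have hcomap : ∀ (b : L) (hb : b ∈ S), (⟨b, hle hb⟩ : S') ∉ 𝔮' → (⟨b, hb⟩ : S) ∉ 𝔮 := fun b hb hbq hbq' => hbq hbq'
  have hS'Λ : S' ≤ Λ := by
    intro z hz
    obtain ⟨a, b, ha, hb, hbq, hb0, rfl⟩ := BadCurveLineage.exists_div_of_quadraticTransform hqt 𝔮' hneq hz
    have hφb : φ (Subring.inclusion hSΛ ⟨b, hb⟩) ≠ 0 := fun h => hcomap b hb hbq ((hkS _).mpr h)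
    have hbinv : b⁻¹ ∈ Λ := ((isUnit_subring_iff_inv_mem _).mp (hΛunit _ hφb)).2
    rw [div_eq_mul_inv]
    exact Λ.mul_mem (hSΛ ha) hbinv
  have hmul : ∀ (u : L) (hu : u ∈ S') (b a : L) (hb : b ∈ S) (ha : a ∈ S), u * b = a →
      φ (Subring.inclusion hS'Λ ⟨u, hu⟩) * φ (Subring.inclusion hSΛ ⟨b, hb⟩) = φ (Subring.inclusion hSΛ ⟨a, ha⟩) := by
    intro u hu b a hb ha hub
    rw [← map_mul]
    congr 1
    exact Subtype.ext hub
  have hkS' : ∀ z : S', z ∈ 𝔮' ↔ φ (Subring.inclusion hS'Λ z) = 0 := by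
    intro z
    rw [BadCurveLineage.mem_iff_of_quadraticTransform hqt 𝔮' hneq z.2]
    constructor
    · rintro ⟨a, b, ha, hb, hbq, haq, hzb⟩
      have hφa : φ (Subring.inclusion hSΛ ⟨a, ha⟩) = 0 := (hkS _).mp haq
      have hφb : φ (Subring.inclusion hSΛ ⟨b, hb⟩) ≠ 0 := fun h => hcomap b hb hbq ((hkS _).mpr h)
      have h := hmul z z.2 b a hb ha hzb
      rw [hφa] at h
      exact (mul_eq_zero.mp h).resolve_right hφb
    · intro hφz
      obtain ⟨a, b, ha, hb, hbq, hb0, hzab⟩ := BadCurveLineage.exists_div_of_quadraticTransform hqt 𝔮' hneq z.2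
      have hzb : (z : L) * b = a := by rw [hzab, div_mul_cancel₀ _ hb0]
      refine ⟨a, b, ha, hb, hbq, ?_, hzb⟩
      apply (hkS _).mpr
      have h := hmul z z.2 b a hb ha hzb
      rw [hφz, zero_mul] at h
      exact h.symm
  /- the germs: `G = φ(S) ≅ S ⧸ 𝔮` (a DVR) and `G' = φ(S') ≅ S' ⧸ 𝔮'`, with `G'` a quadratic transform of `G` -/
  obtain ⟨eG⟩ := LineageFrame.quotientEquivGerm_exists Λ φ hSΛ 𝔮 hkS
  obtain ⟨eG'⟩ := LineageFrame.quotientEquivGerm_exists Λ φ hS'Λ 𝔮' hkS'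
  haveI : IsDomain (S ⧸ 𝔮) := (Ideal.Quotient.isDomain_iff_prime _).mpr inferInstance
  haveI := hreg
  -- (M1): the germ step is a quadratic transform
  obtain ⟨O, hO⟩ := LowTamingGerms.exists_valuationSubring_dominates S'
  obtain ⟨hA', hSO, hdiv, -⟩ := LowTamingGerms.eq_locAtCentre_of_chart hxS hxm hx0 hB hfrac hdom hO
  have hxq' : Subring.inclusion hle ⟨x, hxS⟩ ∉ 𝔮' :=
    BadCurveStep.not_mem_of_comap_ne_maximalIdeal hle (x := ⟨x, hxS⟩) hx0 hB 𝔮' hneq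
  have hxq : (⟨x, hxS⟩ : S) ∉ 𝔮 := hxq'
  have hφx : φ ⟨x, hSΛ hxS⟩ ≠ 0 := fun h => hxq ((hkS _).mpr h)
  have hM1 := LowTower.map_isQuadraticTransform Λ φ hker O S hSΛ hSO x hxS hxm hx0 hdiv hφx
    (by rw [← hA']; exact hS'Λ) (by rw [← hA']; exact hdom)
  have hA'' : ((locAtCentre (blowupRing S x) O).comap Λ.subtype).map φ = (S'.comap Λ.subtype).map φ := by rw [← hA']
  rw [hA'', ← LineageFrame.range_comp_inclusion_eq_map_comap Λ φ hSΛ,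
    ← LineageFrame.range_comp_inclusion_eq_map_comap Λ φ hS'Λ] at hM1
  -- the germ of `𝔮` is a DVR, so the transform is trivial
  haveI : IsDomain (φ.comp (Subring.inclusion hSΛ)).range := inferInstance
  haveI hpid : IsPrincipalIdealRing (φ.comp (Subring.inclusion hSΛ)).range :=
    IsPrincipalIdealRing.of_surjective eG.toRingHom eG.surjective
  haveI hlocG : IsLocalRing (φ.comp (Subring.inclusion hSΛ)).range :=
    IsLocalRing.of_surjective' eG.toRingHom eG.surjective
  have hnf : ¬ IsField (φ.comp (Subring.inclusion hSΛ)).range := fun hF =>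
    IsDiscreteValuationRing.not_isField (S ⧸ 𝔮) (MulEquiv.isField hF eG.toMulEquiv)
  haveI hGdvr : IsDiscreteValuationRing (φ.comp (Subring.inclusion hSΛ)).range :=
    { not_a_field' := (IsLocalRing.isField_iff_maximalIdeal_eq).not.mp hnf }
  have hGG' := CurveLineage.eq_of_quadraticTransform_of_isDiscreteValuationRing hGdvr hM1
  haveI hGreg : IsRegularLocalRing (φ.comp (Subring.inclusion hSΛ)).range := inferInstance
  have hG'reg : IsRegularLocalRing (φ.comp (Subring.inclusion hS'Λ)).range := by
    rw [hGG']; exact hGreg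
  haveI := hG'reg
  exact IsRegularLocalRing.of_ringEquiv eG'.symm

end Summit.ResolutionOfSingularities.ResolutionOfSingularities.Theorems.SwitchingDichotomy.LowTamingStep

end
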